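import Summits.QuantumAdvantage.AdviceFreeQNC0.ScatteredGapCore
import Summits.QuantumAdvantage.AdviceFreeQNC0.FixedBellsDense
import Mathlib.Data.Fin.VecNotation
import Mathlib.Order.Interval.Finset.Fin
import HarnessLib

/-!
# Cell qa-qnc0 — the SCATTERED gap law for three unread coordinates: **`gapLawScatteredThree : GapLawScatteredThree`**
(planner qa-qnc0-p2 g17 `line17/Sketch17.lean` §5, statements `Unread`, `GapLawScattered`, `ScatteredGapSharp`,
`GapLawScatteredThree` VERBATIM; kit j298599 `M_3 = 7/8`)

If no cut reads three input coordinates `I` (ANYWHERE, not necessarily consecutive), then for every charge `c` and every walk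
strategy: `8·#WIN ≤ 7·2ⁿ` — degree-free.  Proof: on the fibre of the bits outside `I` every selector is constant and the win
parity at the fibre point `t ∈ {0,1}³` is the configuration count of `ScatteredGapCore` (`j(g)` = number of coordinates of
`I` before cut `g` — a DOWN-SET of the sorted `I`, `down_iff`; `ρ` = the charge offset); `scat_exists_even` gives a losing point
on every fibre, and fibres have `8` points.  Corollary `not_exact_of_unread_three` (p2's success-ladder rung (E)): an EXACT
strategy reads all but at most two coordinates.

WHAT THIS IS NOT: the sharp constants for `k ≥ 4` (`ScatteredGapSharp`) are not attempted; crux 22907 / 23029 untouched;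
separation NOT moved.
-/

noncomputable section

namespace Summit.QuantumAdvantage.AdviceFreeQNC0

namespace ScatteredGap

open Finset TransferWalk

variable {n : ℕ}

/-! ## Statements (Sketch17 §5, verbatim) -/

/-- no cut reads the coordinates in `I`. -/
def Unread (I : Finset (Fin n)) (y : Fin (n + 1) → (Fin n → Bool) → Bool) : Prop :=
  ∀ g, ∀ u v : Fin n → Bool, (∀ i, i ∉ I → u i = v i) → y g u = y g v

/-- **scattered gap law** (shape): `k` unread coordinates anywhere ⇒ `#win ≤ (1 − num/den)·2^n`. -/
def GapLawScattered (k num den : ℕ) : Prop :=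
  ∀ (n c : ℕ) (I : Finset (Fin n)), I.card = k → ∀ y : Fin (n + 1) → (Fin n → Bool) → Bool,
    Unread I y → den * (univ.filter fun u : Fin n → Bool => ringWinU c y u = true).card ≤ (den - num) * 2 ^ n

/-- the computed sharp constants (`k = 3..10` verified by exhaustion, j298599; conjectured for all `k ≥ 3`). -/
def ScatteredGapSharp : Prop := ∀ k ≥ 3, GapLawScattered k (2 ^ k - 4 - k % 2) (3 * 2 ^ k)

/-- first instance: three unread coordinates anywhere cost an eighth. -/
def GapLawScatteredThree : Prop := GapLawScattered 3 1 8

/-! ## Filling the unread coordinates -/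

/-- `fill I z v`: the input with the coordinates of `I` taken from `v` and the others from `z`. -/
def fill (I : Finset (Fin n)) (z v : Fin n → Bool) : Fin n → Bool := fun i => if i ∈ I then v i else z i

/-- On `I`, `fill` takes the bits of `v`. -/
theorem fill_of_mem {I : Finset (Fin n)} {z v : Fin n → Bool} {i : Fin n} (h : i ∈ I) : fill I z v i = v i := by
  simp [fill, h]

/-- Off `I`, `fill` takes the bits of `z`. -/
theorem fill_of_not_mem {I : Finset (Fin n)} {z v : Fin n → Bool} {i : Fin n} (h : i ∉ I) : fill I z v i = z i := by
  simp [fill, h]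

/-- Prefix weights of a filled input: the base (coordinates of `I` zeroed) plus the filled coordinates before the cut. -/
theorem wtPrefix_fill (I : Finset (Fin n)) (z v : Fin n → Bool) (g : ℕ) :
    wtPrefix (fill I z v) g = wtPrefix (fill I z fun _ => false) g + (I.filter fun i => i.val < g ∧ v i = true).card := by
  classical
  unfold wtPrefix
  rw [card_filter, card_filter, card_filter,
    ← sum_filter_add_sum_filter_not univ (fun i : Fin n => i ∈ I),
    ← sum_filter_add_sum_filter_not univ (fun i : Fin n => i ∈ I) (fun i => if (i.val < g ∧ fill I z (fun _ => false) i = true) then 1 else 0)]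
  have hI : (univ.filter fun i : Fin n => i ∈ I) = I := by ext i; simp
  rw [hI]
  have h1 : ∑ i ∈ I, (if (i.val < g ∧ fill I z v i = true) then 1 else 0) =
      ∑ i ∈ I, (if (i.val < g ∧ v i = true) then 1 else 0) :=
    sum_congr rfl fun i hi => by rw [fill_of_mem hi]
  have h2 : ∑ i ∈ I, (if (i.val < g ∧ fill I z (fun _ => false) i = true) then 1 else 0) = 0 :=
    sum_eq_zero fun i hi => by rw [fill_of_mem hi]; simp
  have h3 : ∑ i ∈ univ.filter (fun i : Fin n => ¬ i ∈ I), (if (i.val < g ∧ fill I z v i = true) then 1 else 0) =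
      ∑ i ∈ univ.filter (fun i : Fin n => ¬ i ∈ I), (if (i.val < g ∧ fill I z (fun _ => false) i = true) then 1 else 0) :=
    sum_congr rfl fun i hi => by rw [mem_filter] at hi; rw [fill_of_not_mem hi.2, fill_of_not_mem hi.2]
  rw [h1, h2, h3]; ring

/-- Total weight of a filled input. -/
theorem wt_fill (I : Finset (Fin n)) (z v : Fin n → Bool) :
    wt (fill I z v) = wt (fill I z fun _ => false) + (I.filter fun i => v i = true).card := by
  rw [wt_eq_wtPrefix, wt_eq_wtPrefix, wtPrefix_fill]
  congr 2; ext i; simp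

/-! ## The sorted unread coordinates and the down-sets -/

/-- A lower set of `Fin m` is an initial segment: membership is `val < card`. -/
theorem mem_iff_lt_card_of_lower {m : ℕ} (D : Finset (Fin m)) (hD : ∀ s s' : Fin m, s' ≤ s → s ∈ D → s' ∈ D) (s : Fin m) :
    s ∈ D ↔ s.val < D.card := by
  constructor
  · intro hs
    have hsub : Finset.Iic s ⊆ D := fun s' hs' => hD s s' (Finset.mem_Iic.1 hs') hs
    have := card_le_card hsub
    rw [Fin.card_Iic] at this
    omega
  · intro hlt
    by_contra hs
    have hsub : D ⊆ Finset.Iio s := by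
      intro s' hs'
      rw [Finset.mem_Iio]
      by_contra hle
      exact hs (hD s' s (not_lt.1 hle) hs')
    have := card_le_card hsub
    rw [Fin.card_Iio] at this
    omega

/-- The fibre point with bits `t` on the sorted coordinates of `I`. -/
def vOf (I : Finset (Fin n)) (hI : I.card = 3) (t : Fin 3 → Bool) : Fin n → Bool :=
  fun i => if h : i ∈ I then t ((I.orderIsoOfFin hI).symm ⟨i, h⟩) else false

/-- Number of coordinates of `I` before cut `g`. -/
def jOf (I : Finset (Fin n)) (g : ℕ) : ℕ := (I.filter fun i => i.val < g).card

/-- At most `|I| = 3` coordinates of `I` precede any cut. -/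
theorem jOf_le (I : Finset (Fin n)) (hI : I.card = 3) (g : ℕ) : jOf I g ≤ 3 := by
  unfold jOf; rw [← hI]; exact card_filter_le _ _

/-- The filled coordinates before cut `g` with bit `1`, counted on `Fin 3`: a down-set count `#{s < j(g) : t s}`. -/
theorem card_filter_vOf (I : Finset (Fin n)) (hI : I.card = 3) (t : Fin 3 → Bool) (g : ℕ) :
    (I.filter fun i => i.val < g ∧ vOf I hI t i = true).card = (univ.filter fun s : Fin 3 => s.val < jOf I g ∧ t s = true).card := by
  classical
  set e := I.orderEmbOfFin hI with he
  -- the down-set of sorted positions before `g`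
  set D : Finset (Fin 3) := univ.filter fun s => (e s).val < g with hD
  have hlow : ∀ s s' : Fin 3, s' ≤ s → s ∈ D → s' ∈ D := by
    intro s s' hss hs
    simp only [hD, mem_filter, mem_univ, true_and] at hs ⊢
    exact lt_of_le_of_lt (by exact_mod_cast e.monotone hss) hs
  have hDcard : D.card = jOf I g := by
    unfold jOf
    rw [hD, ← card_map e.toEmbedding]
    congr 1
    ext i
    simp only [mem_map, mem_filter, mem_univ, true_and]
    constructor
    · rintro ⟨s, hs, rfl⟩
      exact ⟨by rw [he]; exact Finset.orderEmbOfFin_mem I hI s, hs⟩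
    · rintro ⟨hi, hig⟩
      have hr : i ∈ Set.range e := by rw [he, Finset.range_orderEmbOfFin]; exact hi
      obtain ⟨s, rfl⟩ := hr
      exact ⟨s, hig, rfl⟩
  have hdown : ∀ s : Fin 3, (e s).val < g ↔ s.val < jOf I g := by
    intro s
    rw [← hDcard, ← mem_iff_lt_card_of_lower D hlow s]
    simp [hD]
  -- the sorted index of `e s` is `s`
  have hidx : ∀ (s : Fin 3) (hmem : e s ∈ I), (I.orderIsoOfFin hI).symm ⟨e s, hmem⟩ = s := by
    intro s hmem
    apply (I.orderIsoOfFin hI).symm_apply_eq.2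
    ext; simp [he]
  -- transport along `e`
  rw [← card_map e.toEmbedding]
  congr 1
  ext i
  simp only [mem_map, mem_filter, mem_univ, true_and]
  constructor
  · rintro ⟨hi, hig, hv⟩
    have hr : i ∈ Set.range e := by rw [he, Finset.range_orderEmbOfFin]; exact hi
    obtain ⟨s, rfl⟩ := hr
    refine ⟨s, ⟨(hdown s).1 hig, ?_⟩, rfl⟩
    unfold vOf at hv
    rw [dif_pos hi, hidx s hi] at hv
    exact hv
  · rintro ⟨s, ⟨hs, hts⟩, rfl⟩
    have hmem : e s ∈ I := by rw [he]; exact Finset.orderEmbOfFin_mem I hI s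
    refine ⟨hmem, (hdown s).2 hs, ?_⟩
    show vOf I hI t (e s) = true
    unfold vOf
    rw [dif_pos hmem, hidx s hmem]
    exact hts

/-- The down-set counts are the partial sums of the core file. -/
theorem card_lt_eq_psum (t : Fin 3 → Bool) {j : ℕ} (hj : j ≤ 3) :
    (univ.filter fun s : Fin 3 => s.val < j ∧ t s = true).card = psum (t 0) (t 1) (t 2) j := by
  have ht : t = ![t 0, t 1, t 2] := by ext s; fin_cases s <;> rfl
  rw [ht]
  generalize t 0 = a; generalize t 1 = b; generalize t 2 = d
  interval_cases j <;> cases a <;> cases b <;> cases d <;> decide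

/-- The total filled weight. -/
theorem card_vOf (I : Finset (Fin n)) (hI : I.card = 3) (t : Fin 3 → Bool) :
    (I.filter fun i => vOf I hI t i = true).card = (t 0).toNat + (t 1).toNat + (t 2).toNat := by
  have h := card_filter_vOf I hI t n
  have h1 : (I.filter fun i => i.val < n ∧ vOf I hI t i = true) = I.filter fun i => vOf I hI t i = true := by
    ext i; simp
  have hj : jOf I n = 3 := by unfold jOf; rw [← hI]; congr 1; ext i; simp
  rw [h1, hj] at h
  rw [h, card_lt_eq_psum t le_rfl]
  rfl

/-! ## A losing point on every fibre -/

/-- **Every fibre of three unread coordinates contains a losing input.** -/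
theorem exists_lose (c : ℕ) (I : Finset (Fin n)) (hI : I.card = 3) (y : Fin (n + 1) → (Fin n → Bool) → Bool)
    (hy : Unread I y) (z : Fin n → Bool) :
    ∃ t : Fin 3 → Bool, ringWinU c y (fill I z (vOf I hI t)) = false := by
  classical
  set z₀ := fill I z fun _ => false with hz₀
  set A : ℕ → ℕ := fun g => c + g + wt z₀ + wtPrefix z₀ g with hA
  set sel : Fin (n + 1) → Bool := fun g => y g z₀ with hsel
  -- the configuration: parities of the counts of selected cuts by (down-set index, offset)
  set N : ℕ → ℕ → ℕ := fun j ρ => (univ.filter fun g : Fin (n + 1) => sel g = true ∧ jOf I g.val = j ∧ A g.val % 3 = ρ).card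
    with hN
  set nb : ℕ → ℕ → Bool := fun j ρ => decide (N j ρ % 2 = 1) with hnb
  obtain ⟨t0, t1, t2, heven⟩ := scat_exists_even (nb 0 0) (nb 0 1) (nb 0 2) (nb 1 0) (nb 1 1) (nb 1 2)
    (nb 2 0) (nb 2 1) (nb 2 2) (nb 3 0) (nb 3 1) (nb 3 2)
  set t : Fin 3 → Bool := ![t0, t1, t2] with ht
  refine ⟨t, ?_⟩
  set u := fill I z (vOf I hI t) with hu
  -- the selectors and the charges on the fibre
  have hyu : ∀ g, y g u = sel g := fun g => hy g u z₀ fun i hi => by rw [hu, hz₀, fill_of_not_mem hi, fill_of_not_mem hi]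
  have htot : wt u = wt z₀ + ((t 0).toNat + (t 1).toNat + (t 2).toNat) := by rw [hu, wt_fill, card_vOf]
  have hpre : ∀ g : ℕ, wtPrefix u g = wtPrefix z₀ g + psum (t 0) (t 1) (t 2) (jOf I g) := by
    intro g; rw [hu, wtPrefix_fill, card_filter_vOf, card_lt_eq_psum t (jOf_le I hI g)]
  have ht0 : t 0 = t0 := rfl
  have ht1 : t 1 = t1 := rfl
  have ht2 : t 2 = t2 := rfl
  -- the win count on the fibre, grouped by `(jOf, A % 3)`
  set W := univ.filter fun g : Fin (n + 1) => y g u = true ∧ (c + g.val + walkExp u g.val) % 3 ≠ 0 with hW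
  have hcond : ∀ g : Fin (n + 1), ((c + g.val + walkExp u g.val) % 3 ≠ 0) ↔
      ((A g.val % 3 + (t0.toNat + t1.toNat + t2.toNat) + psum t0 t1 t2 (jOf I g.val)) % 3 ≠ 0) := by
    intro g
    unfold walkExp
    rw [htot, hpre, ht0, ht1, ht2]
    have : c + g.val + (wt z₀ + (t0.toNat + t1.toNat + t2.toNat) + (wtPrefix z₀ g.val + psum t0 t1 t2 (jOf I g.val))) =
        A g.val + ((t0.toNat + t1.toNat + t2.toNat) + psum t0 t1 t2 (jOf I g.val)) := by simp only [hA]; ring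
    rw [this, show (A g.val + ((t0.toNat + t1.toNat + t2.toNat) + psum t0 t1 t2 (jOf I g.val))) % 3 =
      (A g.val % 3 + (t0.toNat + t1.toNat + t2.toNat) + psum t0 t1 t2 (jOf I g.val)) % 3 by omega]
  have hWcard : W.card = ∑ jρ ∈ (range 4) ×ˢ (range 3),
      (if ((jρ.2 + (t0.toNat + t1.toNat + t2.toNat) + psum t0 t1 t2 jρ.1) % 3 ≠ 0) then N jρ.1 jρ.2 else 0) := by
    rw [card_eq_sum_card_fiberwise (f := fun g : Fin (n + 1) => (jOf I g.val, A g.val % 3)) (t := (range 4) ×ˢ (range 3))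
      (fun g _ => by
        simp only [Finset.mem_coe, mem_product, mem_range]
        exact ⟨Nat.lt_succ_of_le (jOf_le I hI g.val), Nat.mod_lt _ (by norm_num)⟩)]
    refine sum_congr rfl fun jρ _ => ?_
    obtain ⟨j, ρ⟩ := jρ
    simp only
    split_ifs with hχ
    · simp only [hN]
      congr 1
      ext g
      simp only [hW, mem_filter, mem_univ, true_and, hyu, Prod.mk.injEq]
      constructor
      · rintro ⟨⟨hs, _⟩, hj, hρ⟩; exact ⟨hs, hj, hρ⟩
      · rintro ⟨hs, hj, hρ⟩
        refine ⟨⟨hs, ?_⟩, hj, hρ⟩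
        rw [hcond g, hρ, hj]; exact hχ
    · rw [card_eq_zero, filter_eq_empty_iff]
      intro g hg
      simp only [hW, mem_filter, mem_univ, true_and, Prod.mk.injEq] at hg ⊢
      rintro ⟨hj, hρ⟩
      have := (hcond g).1 hg.2
      rw [hρ, hj] at this
      exact hχ this
  -- parity of the grouped count = the core count
  have hterm : ∀ j ρ : ℕ, (if ((ρ + (t0.toNat + t1.toNat + t2.toNat) + psum t0 t1 t2 j) % 3 ≠ 0) then N j ρ else 0) % 2 =
      term (nb j ρ) j ρ t0 t1 t2 := by
    intro j ρ
    simp only [term, hnb, decide_eq_true_eq]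
    by_cases hχ : (ρ + (t0.toNat + t1.toNat + t2.toNat) + psum t0 t1 t2 j) % 3 ≠ 0
    · rw [if_pos hχ]
      by_cases hp : N j ρ % 2 = 1
      · rw [if_pos ⟨hp, hχ⟩]; exact hp
      · rw [if_neg (fun h => hp h.1)]; omega
    · rw [if_neg hχ, if_neg (fun h => hχ h.2)]
  have hpar : W.card % 2 = cnt (nb 0 0) (nb 0 1) (nb 0 2) (nb 1 0) (nb 1 1) (nb 1 2) (nb 2 0) (nb 2 1) (nb 2 2)
      (nb 3 0) (nb 3 1) (nb 3 2) t0 t1 t2 % 2 := by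
    rw [hWcard, Finset.sum_product]
    simp only [Finset.sum_range_succ, Finset.sum_range_zero]
    simp only [cnt]
    have h00 := hterm 0 0; have h01 := hterm 0 1; have h02 := hterm 0 2
    have h10 := hterm 1 0; have h11 := hterm 1 1; have h12 := hterm 1 2
    have h20 := hterm 2 0; have h21 := hterm 2 1; have h22 := hterm 2 2
    have h30 := hterm 3 0; have h31 := hterm 3 1; have h32 := hterm 3 2
    omega
  -- conclude
  rw [Bool.eq_false_iff]
  intro hwin
  unfold ringWinU at hwin
  rw [decide_eq_true_eq] at hwin
  have : W.card % 2 = 1 := hwin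
  rw [hpar] at this
  omega

/-! ## Counting over the fibres -/

/-- **`gapLawScatteredThree : GapLawScatteredThree` — PROVED.** -/
theorem gapLawScatteredThree : GapLawScatteredThree := by
  classical
  intro n c I hI y hy
  -- the projection killing the coordinates of `I`
  set Φ : (Fin n → Bool) → (Fin n → Bool) := fun u => fill I u fun _ => false with hΦ
  set Win := univ.filter fun u : Fin n → Bool => ringWinU c y u = true with hWin
  set Lose := univ.filter fun u : Fin n → Bool => ¬ ringWinU c y u = true with hLose
  set Img := (univ : Finset (Fin n → Bool)).image Φ with hImg
  -- each fibre has at most `8` points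
  have hfib : ∀ z : Fin n → Bool, (univ.filter fun u : Fin n → Bool => Φ u = z).card ≤ 8 := by
    intro z
    have h := Finset.card_le_card_of_injOn (s := univ.filter fun u : Fin n → Bool => Φ u = z)
      (t := (univ : Finset (Fin 3 → Bool))) (fun u => fun s => u (I.orderEmbOfFin hI s)) (fun _ _ => mem_univ _)
      (by
        intro u hu u' hu' huu
        rw [Finset.mem_coe, mem_filter] at hu hu'
        funext i
        by_cases hi : i ∈ I
        · have hr : i ∈ Set.range (I.orderEmbOfFin hI) := by rw [Finset.range_orderEmbOfFin]; exact hi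
          obtain ⟨s, rfl⟩ := hr
          exact congrFun huu s
        · have h1 := congrFun hu.2 i
          have h2 := congrFun hu'.2 i
          simp only [hΦ, fill_of_not_mem hi] at h1 h2
          rw [h1, h2])
    rw [card_univ, Fintype.card_fun, Fintype.card_bool, Fintype.card_fin] at h
    exact h
  -- hence `2^n ≤ 8 · #Img`
  have hImgCard : 2 ^ n ≤ 8 * Img.card := by
    have h := card_eq_sum_card_fiberwise (f := Φ) (s := (univ : Finset (Fin n → Bool))) (t := Img)
      (fun u _ => mem_image_of_mem Φ (mem_univ u))
    rw [card_univ, Fintype.card_fun, Fintype.card_bool, Fintype.card_fin] at h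
    rw [h]
    calc ∑ z ∈ Img, (univ.filter fun u : Fin n → Bool => Φ u = z).card ≤ ∑ _z ∈ Img, 8 := sum_le_sum fun z _ => hfib z
      _ = 8 * Img.card := by rw [sum_const, smul_eq_mul, mul_comm]
  -- a loser above every image point
  have hlose : ∀ z ∈ Img, ∃ u ∈ Lose, Φ u = z := by
    intro z hz
    rw [hImg, mem_image] at hz
    obtain ⟨u₀, _, rfl⟩ := hz
    obtain ⟨t, ht⟩ := exists_lose c I hI y hy u₀
    refine ⟨fill I u₀ (vOf I hI t), by rw [hLose, mem_filter]; exact ⟨mem_univ _, by rw [ht]; exact Bool.false_ne_true⟩, ?_⟩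
    funext i
    by_cases hi : i ∈ I
    · simp only [hΦ, fill_of_mem hi]
    · simp only [hΦ, fill_of_not_mem hi]
  have hLoseCard : Img.card ≤ Lose.card := by
    choose f hf using hlose
    refine Finset.card_le_card_of_injOn (fun z => if h : z ∈ Img then f z h else z) (fun z hz => by
      rw [Finset.mem_coe] at hz; simp only [dif_pos hz]; exact (hf z hz).1) ?_
    intro z hz z' hz' hzz
    rw [Finset.mem_coe] at hz hz'
    simp only [dif_pos hz, dif_pos hz'] at hzz
    rw [← (hf z hz).2, ← (hf z' hz').2, hzz]
  have htot : Win.card + Lose.card = 2 ^ n := by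
    rw [hWin, hLose, Finset.card_filter_add_card_filter_not, card_univ, Fintype.card_fun, Fintype.card_bool, Fintype.card_fin]
  show 8 * Win.card ≤ (8 - 1) * 2 ^ n
  omega

/-- Success-ladder corollary (degree-free): an EXACT strategy reads all but at most two coordinates. -/
theorem not_exact_of_unread_three (c : ℕ) (I : Finset (Fin n)) (hI : I.card = 3)
    (y : Fin (n + 1) → (Fin n → Bool) → Bool) (hy : Unread I y) : ¬ ∀ u, ringWinU c y u = true := by
  intro hall
  have hb := gapLawScatteredThree n c I hI y hy
  have hfull : (univ.filter fun u : Fin n → Bool => ringWinU c y u = true) = univ :=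
    filter_true_of_mem fun u _ => hall u
  rw [hfull, card_univ, Fintype.card_fun, Fintype.card_bool, Fintype.card_fin] at hb
  have h2 : 0 < 2 ^ n := by positivity
  omega

end ScatteredGap

end Summit.QuantumAdvantage.AdviceFreeQNC0

end
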